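import Mathlib
import Summits.Ventures.PercRepro2.Defs
import Summits.Ventures.PercRepro2.Independence
import Summits.Ventures.PercRepro2.Harris
import Summits.Ventures.PercRepro2.Graph
import Summits.Ventures.PercRepro2.Exploration
import Summits.Ventures.PercRepro2.Events
import Summits.Ventures.PercRepro2.FourFunctions
import Summits.Ventures.PercRepro2.Induced
import Summits.Ventures.PercRepro2.Frontier
import Summits.Ventures.PercRepro2.ObsIndependence
import Summits.Ventures.PercRepro2.BHK
import Summits.Ventures.PercRepro2.BHKEvents
import Summits.Ventures.PercRepro2.VdBKahn
import Summits.Ventures.PercRepro2.BHKAvoid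
import Summits.Ventures.PercRepro2.OrderPreservation
import Summits.Ventures.PercRepro2.OrderPreservationDual
import Summits.Ventures.PercRepro2.R2PrimeThreeReduction
import Summits.Ventures.PercRepro2.YBridge
import Summits.Ventures.PercRepro2.Yu1Functionals
import Summits.Ventures.PercRepro2.Yu1Events
import Summits.Ventures.PercRepro2.Yu1
import Summits.Ventures.PercRepro2.YDeltaTools

/-!
# The multiplier family (Yu1Δ-κ) (blind cell PercRepro2, p1)

Light-first exploration as in `YDeltaTools`. For `κ ≥ 1` put `Θ_κ := u · (1 + (κ − 1)·1{b ∈ ·})`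
(increasing) and the multiplier `g := c_u·ψ − c_ψ·Θ_κ` with `c_u = E[Θ_κ; R] = P(PD) + (κ−1)·P(PD, b ∈ C₁)`,
`c_ψ = E[ψ; R] = W = M₂ + Δ_T`. `g` is antitone as soon as `c_ψ·κ ≥ c_u`, and `E[g; R] = 0`; BHK
(`bhk_induced`, `F₁ = 1{o ∈ ·}`, `F₂ = c_u − g`) then gives

**`yu1Delta_kappa`**: `(T_{l→h} − Δ_l) · (P(PD) + (κ−1)·P(PD, b ∈ C₁)) ≤ W · (P(PD, o ∈ C₁) + (κ−1)·P(PD, o ∈ C₁, b ∈ C₁))`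
for every `κ ≥ 1` with `P(PD) + (κ−1)·P(PD, b ∈ C₁) ≤ κ·W`.

`κ = 1` is the regime theorem `yu1Delta_of_regime` (`P(PD) ≤ W`); `κ → ∞` is the lead's (L_B)
(`proofs/LEAD-PROOFSHAPES.md` §8.9 ADDENDUM 13 (2)); the family is exactly what a pointwise
multiplier can prove — (Yu1Δ) itself is the statement at `κ = 1` without the side condition.
-/

namespace Summit.Ventures.PercRepro2

open UnionCluster Yu1

section Kappa

variable {V : Type*} {E : Type*} [Fintype E] [DecidableEq E] [Fintype V] [DecidableEq V]
  {R : Type*} [Field R] [LinearOrder R] [IsStrictOrderedRing R]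

omit [Fintype V] [DecidableEq V] in
/-- **The κ-multiplier is antitone**: for `0 ≤ c`, `0 ≤ c'`, `1 ≤ κ`, `c ≤ c'·κ`,
`S ↦ c·(β(S) − 1{b ∈ S}(1 − u(S))) − c'·u(S)·(1 + (κ − 1)·1{b ∈ S})` is decreasing (`b ≠ a₂`). -/
lemma multiplier_kappa_antitone (p : E → R) (hp : IsProbVec p) (ends : E → Sym2 V) {a₂ a₃ b : V}
    (hb : b ≠ a₂) {c c' κ : R} (hc : 0 ≤ c) (hc' : 0 ≤ c') (hκ1 : 1 ≤ κ) (hcc : c ≤ c' * κ) :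
    Antitone (fun W : Set V => c * (beta p ends a₂ b W - ind b W * (1 - u p ends a₂ a₃ W)) -
      c' * (u p ends a₂ a₃ W * (1 + (κ - 1) * ind b W))) := by
  intro W W' hWW'
  simp only
  have hu := u_mono p hp ends a₂ a₃ hWW'
  have hβ := beta_anti p hp ends a₂ b hWW'
  have hu0 := u_nonneg p hp ends a₂ a₃ W
  have hu1 := u_le_one p hp ends a₂ a₃ W'
  have hu0' := u_nonneg p hp ends a₂ a₃ W'
  have hβ0 := beta_nonneg p hp ends a₂ b W
  have hβ1 := beta_le_one p hp ends a₂ b W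
  by_cases hbW : b ∈ W
  · have hbW' : b ∈ W' := hWW' hbW
    rw [beta_eq_zero_of_mem p ends hb hbW, beta_eq_zero_of_mem p ends hb hbW']
    simp only [ind, Set.indicator_of_mem (show W ∈ {W : Set V | b ∈ W} from hbW),
      Set.indicator_of_mem (show W' ∈ {W : Set V | b ∈ W} from hbW'), Pi.one_apply]
    nlinarith
  · have h0 : (ind b W : R) = 0 := by
      unfold ind
      exact Set.indicator_of_notMem (show W ∉ {W' : Set V | b ∈ W'} from hbW) _
    rw [h0]
    by_cases hbW' : b ∈ W'
    · rw [beta_eq_zero_of_mem p ends hb hbW']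
      simp only [ind, Set.indicator_of_mem (show W' ∈ {W : Set V | b ∈ W} from hbW'), Pi.one_apply]
      nlinarith [mul_nonneg hc' (mul_nonneg hu0' (sub_nonneg.2 hκ1))]
    · have h0' : (ind b W' : R) = 0 := by
        unfold ind
        exact Set.indicator_of_notMem (show W' ∉ {W'' : Set V | b ∈ W''} from hbW') _
      rw [h0']
      nlinarith

omit [LinearOrder R] [IsStrictOrderedRing R] in
/-- Tower identity: `P(PD, o ∈ C₁, b ∈ C₁) = E[1_o 1_b u; R]`. -/
lemma reg_tower_PDob (p : E → R) (ends : E → Sym2 V) (o a₁ a₂ a₃ b : V) :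
    prob p (PDEvent ends a₁ a₂ a₃ ∩ connEvent ends a₁ o ∩ connEvent ends a₁ b) =
      expect p (fun ω => ind o (cluster ends ω a₁) * ind b (cluster ends ω a₁) *
        u p ends a₂ a₃ (cluster ends ω a₁) * (avoidAll ends a₁ {a₂, a₃}).indicator 1 ω) := by
  have e : PDEvent ends a₁ a₂ a₃ ∩ connEvent ends a₁ o ∩ connEvent ends a₁ b =
      clusterInEvent ends a₁ ({W | o ∈ W} ∩ {W | b ∈ W}) ∩ clusterInEvent ends a₂ {W | a₃ ∉ W} ∩
        avoidAll ends a₁ {a₂, a₃} := by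
    have h := PDo_event_eq ends o a₁ a₂ a₃
    ext ω
    have hω := congrArg (fun S : Set (Config E) => ω ∈ S) h
    simp only [eq_iff_iff, Set.mem_inter_iff, clusterInEvent, Set.mem_setOf_eq, mem_cluster,
      mem_connEvent] at hω ⊢
    tauto
  rw [e, prob_clusterIn_inter_avoid_eq_expect p ends a₁ a₂ (X := {a₂, a₃})
    (Finset.mem_insert_self a₂ {a₃})]
  unfold expect
  refine Finset.sum_congr rfl fun ω _ => ?_
  simp only []
  unfold ind u
  by_cases ho : o ∈ cluster ends ω a₁ <;> by_cases hb : b ∈ cluster ends ω a₁ <;>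
    simp [ho, hb]

set_option maxHeartbeats 400000 in
/-- **(Yu1Δ-κ)**: for `κ ≥ 1` with `P(PD) + (κ−1)·P(PD, b ∈ C₁) ≤ κ·(M₂ + Δ_T)` (`b ≠ a₂`),
`(T_{l→h} − Δ_l) · (P(PD) + (κ−1)·P(PD, b ∈ C₁)) ≤ (M₂ + Δ_T) · (P(PD, o ∈ C₁) + (κ−1)·P(PD, o ∈ C₁, b ∈ C₁))`.
`κ = 1`: the regime theorem; `κ → ∞`: (L_B). -/
theorem yu1Delta_kappa (p : E → R) (hp : IsProbVec p) (ends : E → Sym2 V) {o a₁ a₂ a₃ b : V}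
    (hb : b ≠ a₂) {κ : R} (hκ1 : 1 ≤ κ)
    (hκ : prob p (PDEvent ends a₁ a₂ a₃) +
        (κ - 1) * prob p (PDEvent ends a₁ a₂ a₃ ∩ connEvent ends a₁ b) ≤
      κ * (massM2 p ends a₁ a₂ a₃ b + deltaT p ends a₁ a₂ a₃ b)) :
    (prob p (PDEvent ends a₁ a₂ a₃ ∩ connEvent ends a₁ o ∩ connEvent ends a₂ b) -
        (prob p ((connEvent ends a₁ a₂)ᶜ ∩ connEvent ends a₁ o ∩ connEvent ends a₂ a₃ ∩
            connEvent ends a₁ b) -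
          prob p ((connEvent ends a₁ a₂)ᶜ ∩ connEvent ends a₁ o ∩ connEvent ends a₂ a₃ ∩
            connEvent ends a₂ b))) *
        (prob p (PDEvent ends a₁ a₂ a₃) +
          (κ - 1) * prob p (PDEvent ends a₁ a₂ a₃ ∩ connEvent ends a₁ b)) ≤
      (massM2 p ends a₁ a₂ a₃ b + deltaT p ends a₁ a₂ a₃ b) *
        (prob p (PDEvent ends a₁ a₂ a₃ ∩ connEvent ends a₁ o) +
          (κ - 1) * prob p (PDEvent ends a₁ a₂ a₃ ∩ connEvent ends a₁ o ∩ connEvent ends a₁ b)) := by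
  classical
  rcases (prob_nonneg hp (avoidAll ends a₁ {a₂, a₃})).lt_or_eq with hpos | hzero
  swap
  · have hPD0 : prob p (PDEvent ends a₁ a₂ a₃) = 0 :=
      le_antisymm (hzero ▸ prob_mono hp (PD_subset_avoid ends a₁ a₂ a₃)) (prob_nonneg hp _)
    have hPDb0 : prob p (PDEvent ends a₁ a₂ a₃ ∩ connEvent ends a₁ b) = 0 :=
      le_antisymm (hPD0 ▸ prob_mono hp Set.inter_subset_left) (prob_nonneg hp _)
    have hPDo0 : prob p (PDEvent ends a₁ a₂ a₃ ∩ connEvent ends a₁ o) = 0 :=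
      le_antisymm (hPD0 ▸ prob_mono hp Set.inter_subset_left) (prob_nonneg hp _)
    have hPDob0 : prob p (PDEvent ends a₁ a₂ a₃ ∩ connEvent ends a₁ o ∩ connEvent ends a₁ b) = 0 :=
      le_antisymm (hPDo0 ▸ prob_mono hp Set.inter_subset_left) (prob_nonneg hp _)
    rw [hPD0, hPDb0, hPDo0, hPDob0]
    simp
  have hMΔ : massM2 p ends a₁ a₂ a₃ b + deltaT p ends a₁ a₂ a₃ b =
      prob p (connEvent ends a₂ b ∩ avoidAll ends a₁ {a₂, a₃}) -
        prob p (connEvent ends a₁ b ∩ TEvent ends a₁ a₂ a₃) := by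
    rw [Nh_eq p ends a₁ a₂ a₃ b]
    unfold deltaT
    ring
  have hsplit := prob_inter_add_prob_inter_compl p
    (connEvent ends a₁ o ∩ connEvent ends a₂ b ∩ avoidAll ends a₁ {a₂, a₃}) (connEvent ends a₂ a₃)
  rw [ob_split_eq₁, ob_split_eq₂] at hsplit
  have hL : prob p (PDEvent ends a₁ a₂ a₃ ∩ connEvent ends a₁ o ∩ connEvent ends a₂ b) -
      (prob p ((connEvent ends a₁ a₂)ᶜ ∩ connEvent ends a₁ o ∩ connEvent ends a₂ a₃ ∩
          connEvent ends a₁ b) -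
        prob p ((connEvent ends a₁ a₂)ᶜ ∩ connEvent ends a₁ o ∩ connEvent ends a₂ a₃ ∩
          connEvent ends a₂ b)) =
      prob p (connEvent ends a₁ o ∩ connEvent ends a₂ b ∩ avoidAll ends a₁ {a₂, a₃}) -
        prob p (connEvent ends a₁ o ∩ connEvent ends a₁ b ∩ connEvent ends a₂ a₃ ∩
          avoidAll ends a₁ {a₂, a₃}) := by
    rw [← dl1_event_eq]
    linarith
  rw [hMΔ] at hκ ⊢
  have hPDb := tower_PDo p ends b a₁ a₂ a₃
  rw [hL, reg_tower_ob, reg_tower_obT, tower_PD, tower_PDo p ends o a₁ a₂ a₃, tower_N, tower_r, hPDb,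
    reg_tower_PDob]
  rw [tower_PD, tower_N, tower_r, hPDb] at hκ
  set Rv : Set (Config E) := avoidAll ends a₁ {a₂, a₃} with hRv
  set A := expect p (fun ω => ind o (cluster ends ω a₁) * beta p ends a₂ b (cluster ends ω a₁) *
    Rv.indicator 1 ω) with hA
  set B := expect p (fun ω => ind o (cluster ends ω a₁) * ind b (cluster ends ω a₁) *
    (1 - u p ends a₂ a₃ (cluster ends ω a₁)) * Rv.indicator 1 ω) with hB
  set Du := expect p (fun ω => u p ends a₂ a₃ (cluster ends ω a₁) * Rv.indicator 1 ω) with hDu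
  set Db := expect p (fun ω => ind b (cluster ends ω a₁) * u p ends a₂ a₃ (cluster ends ω a₁) *
    Rv.indicator 1 ω) with hDb
  set Ou := expect p (fun ω => ind o (cluster ends ω a₁) * u p ends a₂ a₃ (cluster ends ω a₁) *
    Rv.indicator 1 ω) with hOu
  set Ob := expect p (fun ω => ind o (cluster ends ω a₁) * ind b (cluster ends ω a₁) *
    u p ends a₂ a₃ (cluster ends ω a₁) * Rv.indicator 1 ω) with hOb
  set N := expect p (fun ω => beta p ends a₂ b (cluster ends ω a₁) * Rv.indicator 1 ω) with hN
  set Rb := expect p (fun ω => ind b (cluster ends ω a₁) * (1 - u p ends a₂ a₃ (cluster ends ω a₁)) *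
    Rv.indicator 1 ω) with hRb
  -- constants: `c_u = Du + (κ−1) Db = E[Θ_κ; R]`, `c_ψ = N − Rb = W`
  have hind : ∀ ω, (0 : R) ≤ Rv.indicator 1 ω := fun ω =>
    Set.indicator_apply_nonneg fun _ => zero_le_one
  have hDu0 : 0 ≤ Du :=
    expect_nonneg hp fun ω => mul_nonneg (u_nonneg p hp ends a₂ a₃ _) (hind ω)
  have hDb0 : 0 ≤ Db :=
    expect_nonneg hp fun ω => mul_nonneg (mul_nonneg (ind_nonneg (R := R) b _)
      (u_nonneg p hp ends a₂ a₃ _)) (hind ω)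
  have hcu0 : 0 ≤ Du + (κ - 1) * Db := by nlinarith [mul_nonneg (sub_nonneg.2 hκ1) hDb0]
  have hcψ0 : 0 ≤ N - Rb := by
    by_contra hneg
    have hneg' : N - Rb < 0 := lt_of_not_ge hneg
    have : κ * (N - Rb) < 0 := mul_neg_of_pos_of_neg (by linarith) hneg'
    linarith
  have hκ' : Du + (κ - 1) * Db ≤ (N - Rb) * κ := by rw [mul_comm (N - Rb) κ]; exact hκ
  have hanti := multiplier_kappa_antitone p hp ends (a₃ := a₃) hb hcu0 hcψ0 hκ1 hκ'
  set g : Set V → R := fun W => (Du + (κ - 1) * Db) *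
      (beta p ends a₂ b W - ind b W * (1 - u p ends a₂ a₃ W)) -
    (N - Rb) * (u p ends a₂ a₃ W * (1 + (κ - 1) * ind b W)) with hg
  have hF₂ : Monotone (fun W => (Du + (κ - 1) * Db) - g W) := fun W W' h => by
    simp only
    linarith [hanti h]
  have hF₂0 : ∀ W, 0 ≤ (Du + (κ - 1) * Db) - g W := fun W => by
    simp only [hg]
    have h1 := beta_le_one p hp ends a₂ b W
    have h2 := ind_nonneg (R := R) b W
    have h3 := u_le_one p hp ends a₂ a₃ W
    have h4 := u_nonneg p hp ends a₂ a₃ W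
    have h5 : 0 ≤ 1 + (κ - 1) * ind b W := by nlinarith [mul_nonneg (sub_nonneg.2 hκ1) h2]
    nlinarith [mul_nonneg h2 (sub_nonneg.2 h3), mul_nonneg hcψ0 (mul_nonneg h4 h5),
      mul_nonneg hcu0 (sub_nonneg.2 h1)]
  have key := bhk_induced p hp ends a₁ (ind_mono (R := R) o) hF₂ (ind_nonneg (R := R) o) hF₂0
    Finset.univ {a₂, a₃} {a₂, a₃} (Finset.subset_univ _) (Finset.subset_univ _)
  simp only [Finset.inter_self, Finset.union_self, REvent_univ] at key
  have e : ∀ F : Set V → R, clusterObs ends Finset.univ a₁ F * (avoidAll ends a₁ {a₂, a₃}).indicator 1 =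
      fun ω => F (cluster ends ω a₁) * (avoidAll ends a₁ {a₂, a₃}).indicator 1 ω := by
    intro F
    funext ω
    simp only [Pi.mul_apply, clusterObs_apply, clusterIn_univ]
  rw [e, e, e] at key
  simp only [Pi.mul_apply] at key
  have eR : prob p Rv = expect p fun ω => Rv.indicator 1 ω := prob_eq_expect_indicator p _
  have e2 : expect p (fun ω => ((Du + (κ - 1) * Db) - g (cluster ends ω a₁)) * Rv.indicator 1 ω) =
      (Du + (κ - 1) * Db) * prob p Rv -
        expect p (fun ω => g (cluster ends ω a₁) * Rv.indicator 1 ω) := by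
    rw [eR, ← expect_const_mul p (Du + (κ - 1) * Db) (fun ω => Rv.indicator 1 ω), ← expect_sub]
    congr 1
    funext ω
    simp only [Pi.sub_apply]
    ring
  have e3 : expect p (fun ω => ind o (cluster ends ω a₁) * ((Du + (κ - 1) * Db) -
      g (cluster ends ω a₁)) * Rv.indicator 1 ω) =
      (Du + (κ - 1) * Db) * expect p (fun ω => ind o (cluster ends ω a₁) * Rv.indicator 1 ω) -
        expect p (fun ω => ind o (cluster ends ω a₁) * g (cluster ends ω a₁) * Rv.indicator 1 ω) := by
    rw [← expect_const_mul p (Du + (κ - 1) * Db)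
      (fun ω => ind o (cluster ends ω a₁) * Rv.indicator 1 ω), ← expect_sub]
    congr 1
    funext ω
    simp only [Pi.sub_apply]
    ring
  -- `E[Θ_κ; R] = Du + (κ−1) Db` and `E[1_o Θ_κ; R] = Ou + (κ−1) Ob`
  have eΘ : expect p (fun ω => u p ends a₂ a₃ (cluster ends ω a₁) *
      (1 + (κ - 1) * ind b (cluster ends ω a₁)) * Rv.indicator 1 ω) = Du + (κ - 1) * Db := by
    have : (fun ω => u p ends a₂ a₃ (cluster ends ω a₁) * (1 + (κ - 1) * ind b (cluster ends ω a₁)) *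
        Rv.indicator 1 ω) =
        (fun ω => 1 * (u p ends a₂ a₃ (cluster ends ω a₁) * Rv.indicator 1 ω - 0) -
          (-(κ - 1)) * (ind b (cluster ends ω a₁) * u p ends a₂ a₃ (cluster ends ω a₁) *
            Rv.indicator 1 ω)) := by
      funext ω
      ring
    rw [this, expect_lin, ← hDu, ← hDb]
    have h0 : expect p (fun _ : Config E => (0 : R)) = 0 := by simp [expect]
    rw [h0]
    ring
  have eoΘ : expect p (fun ω => ind o (cluster ends ω a₁) * (u p ends a₂ a₃ (cluster ends ω a₁) *
      (1 + (κ - 1) * ind b (cluster ends ω a₁))) * Rv.indicator 1 ω) = Ou + (κ - 1) * Ob := by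
    have : (fun ω => ind o (cluster ends ω a₁) * (u p ends a₂ a₃ (cluster ends ω a₁) *
        (1 + (κ - 1) * ind b (cluster ends ω a₁))) * Rv.indicator 1 ω) =
        (fun ω => 1 * (ind o (cluster ends ω a₁) * u p ends a₂ a₃ (cluster ends ω a₁) *
            Rv.indicator 1 ω - 0) -
          (-(κ - 1)) * (ind o (cluster ends ω a₁) * ind b (cluster ends ω a₁) *
            u p ends a₂ a₃ (cluster ends ω a₁) * Rv.indicator 1 ω)) := by
      funext ω
      ring
    rw [this, expect_lin, ← hOu, ← hOb]
    have h0 : expect p (fun _ : Config E => (0 : R)) = 0 := by simp [expect]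
    rw [h0]
    ring
  have eg : expect p (fun ω => g (cluster ends ω a₁) * Rv.indicator 1 ω) = 0 := by
    have : (fun ω => g (cluster ends ω a₁) * Rv.indicator 1 ω) =
        (fun ω => (Du + (κ - 1) * Db) * (beta p ends a₂ b (cluster ends ω a₁) * Rv.indicator 1 ω -
          ind b (cluster ends ω a₁) * (1 - u p ends a₂ a₃ (cluster ends ω a₁)) * Rv.indicator 1 ω) -
          (N - Rb) * (u p ends a₂ a₃ (cluster ends ω a₁) *
            (1 + (κ - 1) * ind b (cluster ends ω a₁)) * Rv.indicator 1 ω)) := by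
      funext ω
      simp only [hg]
      ring
    rw [this, expect_lin, ← hN, ← hRb, eΘ]
    ring
  have eog : expect p (fun ω => ind o (cluster ends ω a₁) * g (cluster ends ω a₁) *
      Rv.indicator 1 ω) = (Du + (κ - 1) * Db) * (A - B) - (N - Rb) * (Ou + (κ - 1) * Ob) := by
    have : (fun ω => ind o (cluster ends ω a₁) * g (cluster ends ω a₁) * Rv.indicator 1 ω) =
        (fun ω => (Du + (κ - 1) * Db) *
            (ind o (cluster ends ω a₁) * beta p ends a₂ b (cluster ends ω a₁) * Rv.indicator 1 ω -
          ind o (cluster ends ω a₁) * ind b (cluster ends ω a₁) *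
            (1 - u p ends a₂ a₃ (cluster ends ω a₁)) * Rv.indicator 1 ω) -
          (N - Rb) * (ind o (cluster ends ω a₁) * (u p ends a₂ a₃ (cluster ends ω a₁) *
            (1 + (κ - 1) * ind b (cluster ends ω a₁))) * Rv.indicator 1 ω)) := by
      funext ω
      simp only [hg]
      ring
    rw [this, expect_lin, ← hA, ← hB, eoΘ]
  rw [e2, e3, eg, sub_zero, eog] at key
  set Eo := expect p (fun ω => ind o (cluster ends ω a₁) * Rv.indicator 1 ω) with hEo
  set PR := prob p Rv with hPR
  have h1 : Eo * ((Du + (κ - 1) * Db) * PR) = (Du + (κ - 1) * Db) * Eo * PR := by ring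
  have h2 : ((Du + (κ - 1) * Db) * Eo - ((Du + (κ - 1) * Db) * (A - B) -
      (N - Rb) * (Ou + (κ - 1) * Ob))) * PR =
      (Du + (κ - 1) * Db) * Eo * PR - ((Du + (κ - 1) * Db) * (A - B) -
        (N - Rb) * (Ou + (κ - 1) * Ob)) * PR := by ring
  rw [h1, h2] at key
  have hkey : ((Du + (κ - 1) * Db) * (A - B) - (N - Rb) * (Ou + (κ - 1) * Ob)) * PR ≤ 0 := by
    linarith
  have h0 : (Du + (κ - 1) * Db) * (A - B) - (N - Rb) * (Ou + (κ - 1) * Ob) ≤ 0 :=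
    nonpos_of_mul_nonpos_left hkey hpos
  calc (A - B) * (Du + (κ - 1) * Db) = (Du + (κ - 1) * Db) * (A - B) := mul_comm _ _
    _ ≤ (N - Rb) * (Ou + (κ - 1) * Ob) := by linarith [h0]

end Kappa

end Summit.Ventures.PercRepro2
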